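import Literature.AlgebraicTopology.SingularHomology.SphereLikeProductCohomology
import Literature.AlgebraicTopology.CharacteristicClasses.ProjectiveHyperplaneCover
import Mathlib.Analysis.Complex.Convex
import Mathlib.Analysis.Convex.Contractible
import HarnessLib

/-!
# The complex projective line is sphere-like: two affine charts meeting in `ℂ^×`

F. Hirzebruch, *Topological Methods in Algebraic Geometry* (1966), §4.2 (the affine charts
`Uᵢ = {zᵢ ≠ 0}` of `Pₙ(ℂ)`, `Uᵢ ≅ ℂⁿ`), specialised to the projective LINE and put in the form
consumed by `SphereLikeProductCohomology` / `SphereLikeFibre`: for a complex normed space `V`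
with a dual pair `(φ₁, φ₂; v₁, v₂)` (`φᵢ vⱼ = δᵢⱼ`, `v = φ₁(v) v₁ + φ₂(v) v₂`, so `dim V = 2`) the
projective line `ℙ ℂ V` carries the sphere-like data

* `A₁ = U_{φ₁} ∋ [v₁]`, `A₂ = U_{φ₂} ∋ [v₂]` — open, covering, contractible (the affine charts are
  affine lines: `ProjectiveHyperplaneCover.contractibleSpace_chartDomain`, reused);
* `U_{φ₁} ∩ U_{φ₂} ≃ₜ ℂ^×` by `p ↦ φ₂((φ₁ p)⁻¹ p)` with inverse `z ↦ [v₁ + z v₂]`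
  (`interChartHomeomorph`), and `ℂ^×` is circle-like: the two slit planes `ℂ ∖ ℝ≤0`, `ℂ ∖ ℝ≥0`
  (star-convex) meet in `{im > 0} ⊔ {im < 0}` (convex) (`isCircleLike_cstar`).

Hence **`IsDualPair.isSphereLike`**: `ℙ ℂ V` is sphere-like w.r.t. these data, with the
distinguished points `[v₁] ∈ A₁` (the "point at infinity" of the projective completion
`P(L ⊕ ℂ)`, `v₁ = (e, 0)`) and `[v₂] ∈ A₂` (the zero section, `v₂ = (0, 1)`). Consequently
(`SphereLikeFibre`) `H²(ℙ ℂ V; M) ≅ M`, `Hᵏ = 0` for `k ∉ {0, 2}`, and degree-two classes on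
`U × ℙ ℂ V` are detected by a slice and the fibres. Also: circle-like and sphere-like data transport
along homeomorphisms (`IsCircleLike.preimage`, `IsSphereLike.preimage`). Everything is proved; no
named facts.

## References

* F. Hirzebruch, *Topological Methods in Algebraic Geometry*, 3rd ed., Springer 1966, §4.2.
  [Hirzebruch1966]
* A. Hatcher, *Algebraic Topology*, CUP 2002, Example 0.6 / §3.1 (cell structure and cohomology of
  `ℂPⁿ`). [HatcherAT2002]
-/

noncomputable section

open CategoryTheory Set Literature.AlgebraicTopology.SingularHomology
open scoped LinearAlgebra.Projectivization

universe u v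

namespace Literature.AlgebraicTopology.CharacteristicClasses

/-! ### Transport of circle-like and sphere-like data along homeomorphisms -/

section Transport

variable {C : Type u} {C₀ : Type v} [TopologicalSpace C] [TopologicalSpace C₀]

/-- `{x : {x // p x} // q x} ≃ₜ {x // q x}` when `q ⇒ p`. [folklore] -/
def subtypeSubtypeHomeomorph {p q : C → Prop} (h : ∀ x, q x → p x) :
    {x : Subtype p // q x.1} ≃ₜ Subtype q where
  toFun x := ⟨x.1.1, x.2⟩
  invFun y := ⟨⟨y.1, h _ y.2⟩, y.2⟩
  left_inv _ := rfl
  right_inv _ := rfl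
  continuous_toFun := (continuous_subtype_val.comp continuous_subtype_val).subtype_mk _
  continuous_invFun := (continuous_subtype_val.subtype_mk _).subtype_mk _

/-- **Circle-like data pull back along a homeomorphism.** [folklore] -/
theorem _root_.Literature.AlgebraicTopology.SingularHomology.IsCircleLike.preimage {Y₁ Y₂ Zp Zm : Set C₀}
    (h : IsCircleLike C₀ Y₁ Y₂ Zp Zm) (e : C ≃ₜ C₀) :
    IsCircleLike C (e ⁻¹' Y₁) (e ⁻¹' Y₂) (e ⁻¹' Zp) (e ⁻¹' Zm) where
  isOpen_left := h.isOpen_left.preimage e.continuous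
  isOpen_right := h.isOpen_right.preimage e.continuous
  union_eq := by rw [← preimage_union, h.union_eq, preimage_univ]
  contractible_left := by
    haveI := h.contractible_left
    exact (e.sets (s := e ⁻¹' Y₁) (t := Y₁) rfl).contractibleSpace
  contractible_right := by
    haveI := h.contractible_right
    exact (e.sets (s := e ⁻¹' Y₂) (t := Y₂) rfl).contractibleSpace
  isOpen_plus := h.isOpen_plus.preimage e.continuous
  isOpen_minus := h.isOpen_minus.preimage e.continuous
  plus_union_minus := by rw [← preimage_union, h.plus_union_minus, preimage_inter]
  disjoint := h.disjoint.preimage e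
  contractible_plus := by
    haveI := h.contractible_plus
    exact (e.sets (s := e ⁻¹' Zp) (t := Zp) rfl).contractibleSpace
  contractible_minus := by
    haveI := h.contractible_minus
    exact (e.sets (s := e ⁻¹' Zm) (t := Zm) rfl).contractibleSpace

/-- The homeomorphism `e` restricted to the overlap `e⁻¹(A₁) ∩ e⁻¹(A₂) ≃ₜ A₁ ∩ A₂` (Mathlib's
`Homeomorph.sets`). [folklore] -/
abbrev interPreimageHomeomorph (e : C ≃ₜ C₀) (A₁ A₂ : Set C₀) : ↥(e ⁻¹' A₁ ∩ e ⁻¹' A₂) ≃ₜ ↥(A₁ ∩ A₂) :=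
  e.sets (s := e ⁻¹' A₁ ∩ e ⁻¹' A₂) (t := A₁ ∩ A₂) rfl

/-- **Sphere-like data pull back along a homeomorphism.** [folklore] -/
theorem _root_.Literature.AlgebraicTopology.SingularHomology.IsSphereLike.preimage {A₁ A₂ : Set C₀}
    {W₁ W₂ Vp Vm : Set ↥(A₁ ∩ A₂)} (h : IsSphereLike C₀ A₁ A₂ W₁ W₂ Vp Vm) (e : C ≃ₜ C₀) :
    IsSphereLike C (e ⁻¹' A₁) (e ⁻¹' A₂) (interPreimageHomeomorph e A₁ A₂ ⁻¹' W₁)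
      (interPreimageHomeomorph e A₁ A₂ ⁻¹' W₂) (interPreimageHomeomorph e A₁ A₂ ⁻¹' Vp)
      (interPreimageHomeomorph e A₁ A₂ ⁻¹' Vm) where
  isOpen_left := h.isOpen_left.preimage e.continuous
  isOpen_right := h.isOpen_right.preimage e.continuous
  union_eq := by rw [← preimage_union, h.union_eq, preimage_univ]
  contractible_left := by
    haveI := h.contractible_left
    exact (e.sets (s := e ⁻¹' A₁) (t := A₁) rfl).contractibleSpace
  contractible_right := by
    haveI := h.contractible_right
    exact (e.sets (s := e ⁻¹' A₂) (t := A₂) rfl).contractibleSpace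
  circleLike := h.circleLike.preimage (interPreimageHomeomorph e A₁ A₂)

end Transport

/-! ### The punctured plane `ℂ^×` is circle-like -/

section Cstar

/-- The punctured complex plane `ℂ^×` as a subspace of `ℂ`. [folklore] -/
abbrev Cstar : Type := {z : ℂ // z ≠ 0}

namespace Cstar

/-- The slit plane `ℂ ∖ ℝ≤0` inside `ℂ^×`. [folklore] -/
def left : Set Cstar := Subtype.val ⁻¹' Complex.slitPlane

/-- The slit plane `ℂ ∖ ℝ≥0` inside `ℂ^×`. [folklore] -/
def right : Set Cstar := {z | -z.1 ∈ Complex.slitPlane}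

/-- The upper half plane inside `ℂ^×`. [folklore] -/
def upper : Set Cstar := {z | 0 < z.1.im}

/-- The lower half plane inside `ℂ^×`. [folklore] -/
def lower : Set Cstar := {z | z.1.im < 0}

/-- `ℂ ∖ ℝ≤0` is open in `ℂ^×`. [folklore] -/
theorem isOpen_left : IsOpen left := Complex.isOpen_slitPlane.preimage continuous_subtype_val

/-- `ℂ ∖ ℝ≥0` is open in `ℂ^×`. [folklore] -/
theorem isOpen_right : IsOpen right :=
  Complex.isOpen_slitPlane.preimage (continuous_subtype_val.neg)

/-- The upper half plane is open in `ℂ^×`. [folklore] -/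
theorem isOpen_upper : IsOpen upper :=
  isOpen_lt continuous_const (Complex.continuous_im.comp continuous_subtype_val)

/-- The lower half plane is open in `ℂ^×`. [folklore] -/
theorem isOpen_lower : IsOpen lower :=
  isOpen_lt (Complex.continuous_im.comp continuous_subtype_val) continuous_const

/-- `↥left ≃ₜ` the slit plane. [folklore] -/
def leftHomeomorph : ↥left ≃ₜ ↥Complex.slitPlane :=
  subtypeSubtypeHomeomorph (p := fun z : ℂ => z ≠ 0) (q := fun z => z ∈ Complex.slitPlane)
    fun _ hz => Complex.slitPlane_ne_zero hz

/-- `↥right ≃ₜ` the slit plane, by `z ↦ -z`. [folklore] -/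
def rightHomeomorph : ↥right ≃ₜ ↥Complex.slitPlane where
  toFun z := ⟨-z.1.1, z.2⟩
  invFun w := ⟨⟨-w.1, neg_ne_zero.2 (Complex.slitPlane_ne_zero w.2)⟩, by
    change - -w.1 ∈ Complex.slitPlane
    rw [neg_neg]
    exact w.2⟩
  left_inv z := Subtype.ext (Subtype.ext (neg_neg z.1.1))
  right_inv w := Subtype.ext (neg_neg w.1)
  continuous_toFun := by
    apply Continuous.subtype_mk
    exact (continuous_subtype_val.comp continuous_subtype_val).neg
  continuous_invFun := by
    apply Continuous.subtype_mk
    apply Continuous.subtype_mk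
    exact continuous_subtype_val.neg

/-- `↥upper ≃ₜ` the upper half plane. [folklore] -/
def upperHomeomorph : ↥upper ≃ₜ ↥{z : ℂ | 0 < z.im} :=
  subtypeSubtypeHomeomorph (p := fun z : ℂ => z ≠ 0) (q := fun z : ℂ => 0 < z.im) fun z hz h0 => by
    rw [h0, Complex.zero_im] at hz
    exact lt_irrefl 0 hz

/-- `↥lower ≃ₜ` the lower half plane. [folklore] -/
def lowerHomeomorph : ↥lower ≃ₜ ↥{z : ℂ | z.im < 0} :=
  subtypeSubtypeHomeomorph (p := fun z : ℂ => z ≠ 0) (q := fun z : ℂ => z.im < 0) fun z hz h0 => by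
    rw [h0, Complex.zero_im] at hz
    exact lt_irrefl 0 hz

/-- The slit plane is contractible (star-convex at `1`). [folklore] -/
theorem contractibleSpace_slitPlane : ContractibleSpace ↥Complex.slitPlane :=
  Complex.starConvex_one_slitPlane.contractibleSpace ⟨1, Complex.one_mem_slitPlane⟩

/-- **`ℂ^×` is circle-like**: the slit planes `ℂ ∖ ℝ≤0`, `ℂ ∖ ℝ≥0` (star-convex, open, covering
`ℂ^×`) meet in `{im ≠ 0} = {im > 0} ⊔ {im < 0}` (convex). [folklore] -/
theorem isCircleLike : IsCircleLike Cstar left right upper lower where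
  isOpen_left := isOpen_left
  isOpen_right := isOpen_right
  union_eq := eq_univ_of_forall fun z =>
    (Complex.mem_slitPlane_or_neg_mem_slitPlane z.2).elim Or.inl Or.inr
  contractible_left := by
    haveI := contractibleSpace_slitPlane
    exact leftHomeomorph.contractibleSpace
  contractible_right := by
    haveI := contractibleSpace_slitPlane
    exact rightHomeomorph.contractibleSpace
  isOpen_plus := isOpen_upper
  isOpen_minus := isOpen_lower
  plus_union_minus := by
    ext z
    simp only [mem_union, mem_inter_iff, upper, lower, left, right, mem_setOf_eq, mem_preimage,
      Complex.mem_slitPlane_iff, Complex.neg_re, Complex.neg_im, neg_pos, ne_eq, neg_eq_zero]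
    constructor
    · rintro (h | h)
      · exact ⟨Or.inr h.ne', Or.inr h.ne'⟩
      · exact ⟨Or.inr h.ne, Or.inr h.ne⟩
    · rintro ⟨h₁ | h₁, h₂ | h₂⟩
      · exact absurd (h₁.trans h₂) (lt_irrefl _)
      · exact lt_or_gt_of_ne (Ne.symm h₂)
      · exact lt_or_gt_of_ne (Ne.symm h₁)
      · exact lt_or_gt_of_ne (Ne.symm h₁)
  disjoint := Set.disjoint_left.2 fun z (h₁ : 0 < z.1.im) (h₂ : z.1.im < 0) => lt_asymm h₁ h₂
  contractible_plus := by
    haveI : ContractibleSpace ↥{z : ℂ | 0 < z.im} :=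
      (convex_halfSpace_im_gt 0).contractibleSpace ⟨Complex.I, by simp⟩
    exact upperHomeomorph.contractibleSpace
  contractible_minus := by
    haveI : ContractibleSpace ↥{z : ℂ | z.im < 0} :=
      (convex_halfSpace_im_lt 0).contractibleSpace ⟨-Complex.I, by simp⟩
    exact lowerHomeomorph.contractibleSpace

end Cstar

end Cstar

/-! ### The projective line of a two-dimensional space with a dual pair -/

section ProjectiveLine

variable {V : Type v} [NormedAddCommGroup V] [NormedSpace ℂ V]

/-- **A dual pair** `(φ₁, φ₂; v₁, v₂)`: `φᵢ vⱼ = δᵢⱼ` and `v = φ₁(v) v₁ + φ₂(v) v₂` for all `v` (so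
`(v₁, v₂)` is a basis of `V` with dual basis `(φ₁, φ₂)`). [folklore] -/
structure IsDualPair (φ₁ φ₂ : V →L[ℂ] ℂ) (v₁ v₂ : V) : Prop where
  apply₁₁ : φ₁ v₁ = 1
  apply₁₂ : φ₁ v₂ = 0
  apply₂₁ : φ₂ v₁ = 0
  apply₂₂ : φ₂ v₂ = 1
  eq_add : ∀ v, v = φ₁ v • v₁ + φ₂ v • v₂

/-- `[v] = [w]` for equal vectors (rewriting helper). [folklore] -/
theorem Projectivization.mk_congr {v w : V} (h : v = w) (hv : v ≠ 0) (hw : w ≠ 0) :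
    Projectivization.mk ℂ v hv = Projectivization.mk ℂ w hw := by
  subst h
  rfl

/-- `[v] ∈ U_φ` for `φ v = 1`. [folklore] -/
theorem mk_mem_chartDomain_of_apply_eq_one (φ : V →L[ℂ] ℂ) {v : V} (h : φ v = 1) :
    Projectivization.mk ℂ v (ne_zero_of_apply_eq_one h) ∈ chartDomain (φ : Module.Dual ℂ V) := by
  rw [mk_mem_chartDomain_iff]
  change φ v ≠ 0
  rw [h]
  exact one_ne_zero

variable {φ₁ φ₂ : V →L[ℂ] ℂ} {v₁ v₂ : V} (h : IsDualPair φ₁ φ₂ v₁ v₂)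
include h

/-- `φ₁ (v₁ + z v₂) = 1`. [folklore] -/
theorem IsDualPair.apply₁_add_smul (z : ℂ) : φ₁ (v₁ + z • v₂) = 1 := by
  rw [map_add, map_smul, h.apply₁₁, h.apply₁₂, smul_zero, add_zero]

/-- `φ₂ (v₁ + z v₂) = z`. [folklore] -/
theorem IsDualPair.apply₂_add_smul (z : ℂ) : φ₂ (v₁ + z • v₂) = z := by
  rw [map_add, map_smul, h.apply₂₁, h.apply₂₂, smul_eq_mul, mul_one, zero_add]

omit h in
/-- On `U_{φ₁} ∩ U_{φ₂}` the `φ₂`-coordinate of the `φ₁`-normalised representative is nonzero. [folklore] -/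
theorem apply₂_affineRep_ne_zero {p : ℙ ℂ V}
    (hp : p ∈ chartDomain (φ₁ : Module.Dual ℂ V) ∩ chartDomain (φ₂ : Module.Dual ℂ V)) :
    φ₂ (affineRep (φ₁ : Module.Dual ℂ V) p) ≠ 0 := by
  have h2 := hp.2
  rw [← mk_affineRep (φ₁ : Module.Dual ℂ V) hp.1, mk_mem_chartDomain_iff] at h2
  exact h2

omit h in
/-- The `φ₁`-normalised representative on `U_{φ₁} ∩ U_{φ₂}` in the coordinates of the dual pair. [folklore] -/
theorem IsDualPair.affineRep_eq (h : IsDualPair φ₁ φ₂ v₁ v₂) {p : ℙ ℂ V} (hp : p ∈ chartDomain (φ₁ : Module.Dual ℂ V)) :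
    affineRep (φ₁ : Module.Dual ℂ V) p = v₁ + φ₂ (affineRep (φ₁ : Module.Dual ℂ V) p) • v₂ := by
  conv_lhs => rw [h.eq_add (affineRep (φ₁ : Module.Dual ℂ V) p)]
  rw [show φ₁ (affineRep (φ₁ : Module.Dual ℂ V) p) = 1 from apply_affineRep (φ₁ : Module.Dual ℂ V) hp, one_smul]

/-- **`U_{φ₁} ∩ U_{φ₂} ≃ₜ ℂ^×`**, `p ↦ φ₂((φ₁ p)⁻¹ p)`, inverse `z ↦ [v₁ + z v₂]`. [cite: Hirzebruch1966, §4.2] -/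
def IsDualPair.interChartHomeomorph :
    ↥(chartDomain (φ₁ : Module.Dual ℂ V) ∩ chartDomain (φ₂ : Module.Dual ℂ V)) ≃ₜ Cstar where
  toFun p := ⟨φ₂ (affineRep (φ₁ : Module.Dual ℂ V) p.1), apply₂_affineRep_ne_zero p.2⟩
  invFun z := ⟨Projectivization.mk ℂ (v₁ + z.1 • v₂) (ne_zero_of_apply_eq_one (h.apply₁_add_smul z.1)),
    ⟨mk_mem_chartDomain_of_apply_eq_one φ₁ (h.apply₁_add_smul z.1), by
      rw [mk_mem_chartDomain_iff]
      change φ₂ (v₁ + z.1 • v₂) ≠ 0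
      rw [h.apply₂_add_smul]
      exact z.2⟩⟩
  left_inv p := by
    obtain ⟨p, hp⟩ := p
    refine Subtype.ext ?_
    change Projectivization.mk ℂ (v₁ + φ₂ (affineRep (φ₁ : Module.Dual ℂ V) p) • v₂) _ = p
    exact (Projectivization.mk_congr (h.affineRep_eq hp.1).symm _
      (affineRep_ne_zero (φ₁ : Module.Dual ℂ V) hp.1)).trans (mk_affineRep (φ₁ : Module.Dual ℂ V) hp.1)
  right_inv z := Subtype.ext (by
    change φ₂ (affineRep (φ₁ : Module.Dual ℂ V) (Projectivization.mk ℂ (v₁ + z.1 • v₂) _)) = z.1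
    rw [affineRep_mk, show (φ₁ : Module.Dual ℂ V) (v₁ + z.1 • v₂) = φ₁ (v₁ + z.1 • v₂) from rfl,
      h.apply₁_add_smul, inv_one, one_smul, h.apply₂_add_smul])
  continuous_toFun :=
    (φ₂.continuous.comp ((continuousOn_affineRep (φ₁ : Module.Dual ℂ V) φ₁.continuous).comp_continuous
      continuous_subtype_val fun p => p.2.1)).subtype_mk _
  continuous_invFun :=
    ((continuous_const.add (continuous_subtype_val.smul continuous_const)).projectivizationMk fun z =>
      ne_zero_of_apply_eq_one (h.apply₁_add_smul z.1)).subtype_mk _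

/-- `[v₁] ∈ U_{φ₁}` (the point at infinity lies in the first chart). [folklore] -/
theorem IsDualPair.mk_left_mem : Projectivization.mk ℂ v₁ (ne_zero_of_apply_eq_one h.apply₁₁) ∈
    chartDomain (φ₁ : Module.Dual ℂ V) :=
  mk_mem_chartDomain_of_apply_eq_one φ₁ h.apply₁₁

/-- `[v₂] ∈ U_{φ₂}` (the origin lies in the second chart). [folklore] -/
theorem IsDualPair.mk_right_mem : Projectivization.mk ℂ v₂ (ne_zero_of_apply_eq_one h.apply₂₂) ∈
    chartDomain (φ₂ : Module.Dual ℂ V) :=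
  mk_mem_chartDomain_of_apply_eq_one φ₂ h.apply₂₂

/-- **The projective line `ℙ ℂ V` (`dim V = 2`, dual pair chosen) is sphere-like** w.r.t. the two
affine charts and the circle-like structure of `U_{φ₁} ∩ U_{φ₂} ≅ ℂ^×`. [cite: Hirzebruch1966, §4.2] -/
theorem IsDualPair.isSphereLike :
    IsSphereLike (ℙ ℂ V) (chartDomain (φ₁ : Module.Dual ℂ V)) (chartDomain (φ₂ : Module.Dual ℂ V))
      (h.interChartHomeomorph ⁻¹' Cstar.left) (h.interChartHomeomorph ⁻¹' Cstar.right)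
      (h.interChartHomeomorph ⁻¹' Cstar.upper) (h.interChartHomeomorph ⁻¹' Cstar.lower) where
  isOpen_left := isOpen_chartDomain (φ₁ : Module.Dual ℂ V) φ₁.continuous
  isOpen_right := isOpen_chartDomain (φ₂ : Module.Dual ℂ V) φ₂.continuous
  union_eq := by
    refine eq_univ_of_forall fun p => ?_
    induction p using Projectivization.ind with
    | h v hv =>
      by_contra hmem
      rw [mem_union, not_or, mk_mem_chartDomain_iff, mk_mem_chartDomain_iff, not_not, not_not] at hmem
      apply hv
      rw [h.eq_add v, show φ₁ v = (φ₁ : Module.Dual ℂ V) v from rfl, show φ₂ v = (φ₂ : Module.Dual ℂ V) v from rfl,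
        hmem.1, hmem.2, zero_smul, zero_smul, add_zero]
  contractible_left := contractibleSpace_chartDomain h.apply₁₁
  contractible_right := contractibleSpace_chartDomain h.apply₂₂
  circleLike := Cstar.isCircleLike.preimage h.interChartHomeomorph

end ProjectiveLine

end Literature.AlgebraicTopology.CharacteristicClasses
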